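import Literature.AlgebraicGeometry.Frobenioids.Thm42PrimaryStepsReflect
import Literature.AlgebraicGeometry.Frobenioids.PrimaryDvdTotalWeak
import HarnessLib

/-!
# [FrdI] Theorem 4.2 (i): `Ψ` preserves and reflects primary pre-steps — perfect-type forms over
# WEAKLY perf-factorial divisor monoids

Mochizuki, *The geometry of Frobenioids I: the general theory*, Kyushu J. Math. **62** (2008)
293–400, §4, Theorem 4.2 (i), proof p. 78 l. 28 – p. 80 l. 17 (kurims) [cite: MochizukiFrdI2008, Thm. 4.2 (i) p.78];
Def. 2.4 (i) p. 47 [cite: MochizukiFrdI2008, Def. 2.4(i) p.47].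

PROOF-ONLY twin (cell abc-iut, layer L1, seat abc-iut-f-038; no definitions) of the perfect-type primary-pre-step
transport of `Thm42PrimaryStepsPropagation.lean` (seat abc-iut-w4-d099) and `Thm42PrimaryStepsReflect.lean`, with
the hypothesis "`Φ_i(A)` perf-factorial" (`IsPerfFactorial`, Def. 2.4 (i) as printed) replaced by the NAMED
WEAKENING `IsPerfFactorialWeak` of `PerfFactorialWeak.lean` (seat abc-iut-L1-t2: (a)(b)(c) verbatim, (d) replaced
by its consequences (d_ord)/(d_res)).  The arguments are those of the strong files word for word; the only monoid
inputs they draw on perf-factoriality — "the divisors of a primary element are totally ordered" and its converse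
for perfect monoids (Def. 2.4 (i)(b)(c), Prop. 4.1 (ii) p. 76) — are the weak lemmas
`IsPerfFactorialWeak.dvd_total_of_dvd_of_isPrimary` / `IsPerfFactorialWeak.isPrimary_of_dvd_total` of
`PrimaryDvdTotalWeak.lean` (seat abc-iut-L2-d2).  WHY: the divisor monoids of the tempered Frobenioids of
[EtTh] §3 at objects with infinitely many special-fibre components are weakly, not strongly, perf-factorial
(cell finding F-L2d2-1, `PerfFactorialProductCounterexample.lean`); these forms feed the general-type theorem
`PreFrobenioid.isPrimaryPreStep_map_of_preservesPreSteps_weak` (file `Thm42PrimaryStepsOfPreStepsWeak.lean`),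
which discharges the binders `hprim`/`hprim'` of [EtTh] Cor. 3.8 (iii) at the weak data.

* `PreFrobenioid.isPrimary_div_iff_of_isPreStep_weak` — in a Frobenioid of perfect and isotropic type with
  `Φ(A)` weakly perf-factorial, a pre-step `φ : A → B` is primary iff `Div(φ) ≠ 0` and any two pre-steps out of
  `A` through which `φ` factors are comparable (Def. 1.3 (iii)(d));
* `PreFrobenioid.isPrimaryPreStep_map_of_preSteps_weak` / `…_inverse_map_…` / `…_of_map_…` / `…_map_iff_…` —
  an equivalence `Ψ` preserving steps and pre-steps whose quasi-inverse preserves pre-steps (Thm. 3.4 (ii))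
  preserves and reflects primary pre-steps.

The printed case is recovered through `IsPerfFactorial.weak`.  No statement of the paper is re-typed or
strengthened; nothing here bears on [IUTchIII] Cor. 3.12.
-/

namespace Literature.AlgebraicGeometry.Frobenioids

open CategoryTheory Opposite

universe w v v' u u'

namespace PreFrobenioid

/-! ### 1. Primary pre-steps through the order of the pre-steps out of the domain -/

section OneFrobenioid

variable {D : Type u} [Category.{v} D] {Φ : Dᵒᵖ ⥤ CommMonCat.{w}}
  {C : Type u'} [Category.{v'} C] {F : C ⥤ ElemFrobenioid Φ}

/-- **Primary pre-steps via Def. 1.3 (iii)(d), weakly perf-factorial divisor monoids** ("by applying the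
equivalences of categories of Definition 1.3, (iii), (d)", p. 79): in a Frobenioid of perfect and isotropic
type with every `Φ(A)` weakly perf-factorial, a pre-step `φ : A → B` is primary iff `Div(φ) ≠ 0` and, for any
two pre-steps `φ₁ : A → B₁`, `φ₂ : A → B₂` through which `φ` factors, one of `φ₁, φ₂` factors through the
other.  (`Φ(A)` is perfect by Prop. 1.10 (iii); every pre-step is co-angular by Prop. 1.4 (i).)  Twin of
`isPrimary_div_iff_of_isPreStep`. [cite: MochizukiFrdI2008, Thm. 4.2 (i) p.78] -/
theorem isPrimary_div_iff_of_isPreStep_weak (hF : IsFrobenioid F) (hperf : IsOfPerfectType F)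
    (histr : IsOfIsotropicType F) (hpf : Objectwise (fun M _ => IsPerfFactorialWeak M) Φ)
    {A B : C} {φ : A ⟶ B} (hφ : IsPreStep F φ) :
    IsPrimary (Div F φ) ↔ Div F φ ≠ 1 ∧
      ∀ ⦃B₁ B₂ : C⦄ (φ₁ : A ⟶ B₁) (φ₂ : A ⟶ B₂), IsPreStep F φ₁ → IsPreStep F φ₂ →
        (∃ f₁ : B₁ ⟶ B, φ₁ ≫ f₁ = φ) → (∃ f₂ : B₂ ⟶ B, φ₂ ≫ f₂ = φ) →
          (∃ g : B₁ ⟶ B₂, φ₁ ≫ g = φ₂) ∨ (∃ g : B₂ ⟶ B₁, φ₂ ≫ g = φ₁) := by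
  have hco : ∀ {X Y : C} (f : X ⟶ Y), IsCoAngular F f :=
    fun f => isCoAngular_of_isIsotropic_codomains F f fun Z _ => histr Z
  have hpfA : IsPerfFactorialWeak (Φ.obj (op (baseObj F A))) := hpf (baseObj F A)
  have hperfA : IsPerfect (Φ.obj (op (baseObj F A))) := isPerfect_divisorMonoid hF hperf A
  constructor
  · intro hprim
    refine ⟨hprim.1, fun B₁ B₂ φ₁ φ₂ hφ₁ hφ₂ h₁ h₂ => ?_⟩
    obtain ⟨f₁, hf₁⟩ := h₁
    obtain ⟨f₂, hf₂⟩ := h₂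
    have hd₁ : Div F φ₁ ∣ Div F φ := hf₁ ▸ div_dvd_div_comp φ₁ f₁
    have hd₂ : Div F φ₂ ∣ Div F φ := hf₂ ▸ div_dvd_div_comp φ₂ f₂
    rcases hpfA.dvd_total_of_dvd_of_isPrimary hprim hd₁ hd₂ with h12 | h21
    · obtain ⟨g, -, hg⟩ := hF.iii_d_under_full φ₁ φ₂ ⟨hco φ₁, hφ₁⟩ ⟨hco φ₂, hφ₂⟩ h12
      exact Or.inl ⟨g, hg⟩
    · obtain ⟨g, -, hg⟩ := hF.iii_d_under_full φ₂ φ₁ ⟨hco φ₂, hφ₂⟩ ⟨hco φ₁, hφ₁⟩ h21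
      exact Or.inr ⟨g, hg⟩
  · rintro ⟨hne, hcond⟩
    refine hpfA.isPrimary_of_dvd_total hperfA hne fun b c hb hc => ?_
    obtain ⟨B₁, φ₁, hφ₁, hφ₁d⟩ := hF.iii_d_under_surj A b
    obtain ⟨B₂, φ₂, hφ₂, hφ₂d⟩ := hF.iii_d_under_surj A c
    obtain ⟨f₁, -, hf₁⟩ := hF.iii_d_under_full φ₁ φ hφ₁ ⟨hco φ, hφ⟩ (by rw [hφ₁d]; exact hb)
    obtain ⟨f₂, -, hf₂⟩ := hF.iii_d_under_full φ₂ φ hφ₂ ⟨hco φ, hφ⟩ (by rw [hφ₂d]; exact hc)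
    rcases hcond φ₁ φ₂ hφ₁.2 hφ₂.2 ⟨f₁, hf₁⟩ ⟨f₂, hf₂⟩ with ⟨g, hg⟩ | ⟨g, hg⟩
    · left
      rw [← hφ₁d, ← hφ₂d, ← hg]
      exact div_dvd_div_comp φ₁ g
    · right
      rw [← hφ₁d, ← hφ₂d, ← hg]
      exact div_dvd_div_comp φ₂ g

end OneFrobenioid

/-! ### 2. Transport along an equivalence preserving steps and pre-steps -/

section TwoFrobenioids

variable {D₁ : Type u} [Category.{v} D₁] {Φ₁ : D₁ᵒᵖ ⥤ CommMonCat.{w}} {C₁ : Type u'} [Category.{v'} C₁]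
  {D₂ : Type u} [Category.{v} D₂] {Φ₂ : D₂ᵒᵖ ⥤ CommMonCat.{w}} {C₂ : Type u'} [Category.{v'} C₂]
  {F₁ : C₁ ⥤ ElemFrobenioid Φ₁} {F₂ : C₂ ⥤ ElemFrobenioid Φ₂}

/-- **`Ψ` preserves primary pre-steps, weakly perf-factorial divisor monoids** (perfect-type form): Frobenioids
of perfect and isotropic type with every `Φ_i(A)` weakly perf-factorial, `Ψ` an equivalence preserving steps
and pre-steps whose quasi-inverse preserves pre-steps (Thm. 3.4 (ii)).  The order-theoretic criterion
`isPrimary_div_iff_of_isPreStep_weak` is transported along `Ψ`: factorizations of `Ψ(φ)` through pre-steps of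
`C₂` are pulled back through the fully faithful, essentially surjective `Ψ` (pre-steps being reflected,
`isPreStep_of_map_of_inverse`), compared in `C₁`, and the comparison is pushed forward.  Twin of
`isPrimaryPreStep_map_of_preSteps`. [cite: MochizukiFrdI2008, Thm. 4.2 (i) p.78] -/
theorem isPrimaryPreStep_map_of_preSteps_weak (Ψ : C₁ ≌ C₂) (hF₁ : IsFrobenioid F₁) (hF₂ : IsFrobenioid F₂)
    (hperf₁ : IsOfPerfectType F₁) (hperf₂ : IsOfPerfectType F₂)
    (histr₁ : IsOfIsotropicType F₁) (histr₂ : IsOfIsotropicType F₂)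
    (hpf₁ : Objectwise (fun M _ => IsPerfFactorialWeak M) Φ₁)
    (hpf₂ : Objectwise (fun M _ => IsPerfFactorialWeak M) Φ₂)
    (hstep : ∀ ⦃X Y : C₁⦄ (φ : X ⟶ Y), IsStep F₁ φ → IsStep F₂ (Ψ.functor.map φ))
    (hpre : ∀ ⦃X Y : C₁⦄ (φ : X ⟶ Y), IsPreStep F₁ φ → IsPreStep F₂ (Ψ.functor.map φ))
    (hpre' : ∀ ⦃X Y : C₂⦄ (φ : X ⟶ Y), IsPreStep F₂ φ → IsPreStep F₁ (Ψ.inverse.map φ))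
    {A B : C₁} {φ : A ⟶ B} (hφ : IsPrimaryPreStep F₁ φ) : IsPrimaryPreStep F₂ (Ψ.functor.map φ) := by
  obtain ⟨hφpre, hφprim⟩ := hφ
  have hφpre₂ : IsPreStep F₂ (Ψ.functor.map φ) := hpre φ hφpre
  refine ⟨hφpre₂, ?_⟩
  have h₁ := (isPrimary_div_iff_of_isPreStep_weak hF₁ hperf₁ histr₁ hpf₁ hφpre).mp hφprim
  refine (isPrimary_div_iff_of_isPreStep_weak hF₂ hperf₂ histr₂ hpf₂ hφpre₂).mpr ⟨?_, ?_⟩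
  · have hst : IsStep F₁ φ := ⟨hφpre, fun hiso => hφprim.1 (by
      haveI := hiso
      exact isIsometry_of_isIso F₁ hF₁.isPreFrobenioid φ)⟩
    exact div_ne_one_of_isStep histr₂ (hstep φ hst)
  · rintro B₁' B₂' φ₁' φ₂' hφ₁' hφ₂' ⟨f₁', hf₁'⟩ ⟨f₂', hf₂'⟩
    let e₁ : Ψ.functor.obj (Ψ.functor.objPreimage B₁') ≅ B₁' := Ψ.functor.objObjPreimageIso B₁'
    let e₂ : Ψ.functor.obj (Ψ.functor.objPreimage B₂') ≅ B₂' := Ψ.functor.objObjPreimageIso B₂'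
    let φ₁ : A ⟶ Ψ.functor.objPreimage B₁' := Ψ.functor.preimage (φ₁' ≫ e₁.inv)
    let φ₂ : A ⟶ Ψ.functor.objPreimage B₂' := Ψ.functor.preimage (φ₂' ≫ e₂.inv)
    let f₁ : Ψ.functor.objPreimage B₁' ⟶ B := Ψ.functor.preimage (e₁.hom ≫ f₁')
    let f₂ : Ψ.functor.objPreimage B₂' ⟶ B := Ψ.functor.preimage (e₂.hom ≫ f₂')
    have hφ₁m : Ψ.functor.map φ₁ = φ₁' ≫ e₁.inv := Ψ.functor.map_preimage _
    have hφ₂m : Ψ.functor.map φ₂ = φ₂' ≫ e₂.inv := Ψ.functor.map_preimage _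
    have hf₁m : Ψ.functor.map f₁ = e₁.hom ≫ f₁' := Ψ.functor.map_preimage _
    have hf₂m : Ψ.functor.map f₂ = e₂.hom ≫ f₂' := Ψ.functor.map_preimage _
    have hφ₁ : IsPreStep F₁ φ₁ := isPreStep_of_map_of_inverse Ψ hF₁ hpre' φ₁ (by
      rw [hφ₁m]; exact IsPreStep.comp F₂ hφ₁' (isPreStep_of_isIso F₂ _))
    have hφ₂ : IsPreStep F₁ φ₂ := isPreStep_of_map_of_inverse Ψ hF₁ hpre' φ₂ (by
      rw [hφ₂m]; exact IsPreStep.comp F₂ hφ₂' (isPreStep_of_isIso F₂ _))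
    have hfac₁ : φ₁ ≫ f₁ = φ := Ψ.functor.map_injective (by
      rw [Functor.map_comp, hφ₁m, hf₁m, Category.assoc, e₁.inv_hom_id_assoc, hf₁'])
    have hfac₂ : φ₂ ≫ f₂ = φ := Ψ.functor.map_injective (by
      rw [Functor.map_comp, hφ₂m, hf₂m, Category.assoc, e₂.inv_hom_id_assoc, hf₂'])
    rcases h₁.2 φ₁ φ₂ hφ₁ hφ₂ ⟨f₁, hfac₁⟩ ⟨f₂, hfac₂⟩ with ⟨g, hg⟩ | ⟨g, hg⟩
    · refine Or.inl ⟨e₁.inv ≫ Ψ.functor.map g ≫ e₂.hom, ?_⟩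
      calc φ₁' ≫ e₁.inv ≫ Ψ.functor.map g ≫ e₂.hom
          = Ψ.functor.map (φ₁ ≫ g) ≫ e₂.hom := by
            rw [Functor.map_comp, hφ₁m]; simp only [Category.assoc]
        _ = φ₂' := by rw [hg, hφ₂m, Category.assoc, e₂.inv_hom_id, Category.comp_id]
    · refine Or.inr ⟨e₂.inv ≫ Ψ.functor.map g ≫ e₁.hom, ?_⟩
      calc φ₂' ≫ e₂.inv ≫ Ψ.functor.map g ≫ e₁.hom
          = Ψ.functor.map (φ₂ ≫ g) ≫ e₁.hom := by
            rw [Functor.map_comp, hφ₂m]; simp only [Category.assoc]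
        _ = φ₁' := by rw [hg, hφ₁m, Category.assoc, e₁.inv_hom_id, Category.comp_id]

/-- **The quasi-inverse `Ψ⁻¹` preserves primary pre-steps, weakly perf-factorial divisor monoids** (the previous
statement for `Ψ.symm`).  Twin of `isPrimaryPreStep_inverse_map_of_preSteps`.
[cite: MochizukiFrdI2008, Thm. 4.2 (i) p.78] -/
theorem isPrimaryPreStep_inverse_map_of_preSteps_weak (Ψ : C₁ ≌ C₂) (hF₁ : IsFrobenioid F₁)
    (hF₂ : IsFrobenioid F₂) (hperf₁ : IsOfPerfectType F₁) (hperf₂ : IsOfPerfectType F₂)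
    (histr₁ : IsOfIsotropicType F₁) (histr₂ : IsOfIsotropicType F₂)
    (hpf₁ : Objectwise (fun M _ => IsPerfFactorialWeak M) Φ₁)
    (hpf₂ : Objectwise (fun M _ => IsPerfFactorialWeak M) Φ₂)
    (hstep' : ∀ ⦃X Y : C₂⦄ (φ : X ⟶ Y), IsStep F₂ φ → IsStep F₁ (Ψ.inverse.map φ))
    (hpre : ∀ ⦃X Y : C₁⦄ (φ : X ⟶ Y), IsPreStep F₁ φ → IsPreStep F₂ (Ψ.functor.map φ))
    (hpre' : ∀ ⦃X Y : C₂⦄ (φ : X ⟶ Y), IsPreStep F₂ φ → IsPreStep F₁ (Ψ.inverse.map φ))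
    {A B : C₂} {φ : A ⟶ B} (hφ : IsPrimaryPreStep F₂ φ) : IsPrimaryPreStep F₁ (Ψ.inverse.map φ) :=
  isPrimaryPreStep_map_of_preSteps_weak Ψ.symm hF₂ hF₁ hperf₂ hperf₁ histr₂ histr₁ hpf₂ hpf₁ hstep' hpre'
    hpre hφ

/-- **`Ψ` reflects primary pre-steps, weakly perf-factorial divisor monoids**: if `Ψ(φ)` is a primary pre-step
then so is `φ` (`Ψ`, `Ψ⁻¹` preserve pre-steps).  Twin of `isPrimaryPreStep_of_map_of_preSteps`.
[cite: MochizukiFrdI2008, Thm. 4.2 (i) p.78] -/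
theorem isPrimaryPreStep_of_map_of_preSteps_weak (Ψ : C₁ ≌ C₂) (hF₁ : IsFrobenioid F₁)
    (hF₂ : IsFrobenioid F₂) (hperf₁ : IsOfPerfectType F₁) (hperf₂ : IsOfPerfectType F₂)
    (histr₁ : IsOfIsotropicType F₁) (histr₂ : IsOfIsotropicType F₂)
    (hpf₁ : Objectwise (fun M _ => IsPerfFactorialWeak M) Φ₁)
    (hpf₂ : Objectwise (fun M _ => IsPerfFactorialWeak M) Φ₂)
    (hpre : ∀ ⦃X Y : C₁⦄ (φ : X ⟶ Y), IsPreStep F₁ φ → IsPreStep F₂ (Ψ.functor.map φ))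
    (hpre' : ∀ ⦃X Y : C₂⦄ (φ : X ⟶ Y), IsPreStep F₂ φ → IsPreStep F₁ (Ψ.inverse.map φ))
    {A B : C₁} {φ : A ⟶ B} (h : IsPrimaryPreStep F₂ (Ψ.functor.map φ)) : IsPrimaryPreStep F₁ φ := by
  obtain ⟨hpp, hprim⟩ := h
  have hφpre : IsPreStep F₁ φ := isPreStep_of_map_of_inverse Ψ hF₁ hpre' φ hpp
  refine ⟨hφpre, ?_⟩
  have h₂ := (isPrimary_div_iff_of_isPreStep_weak hF₂ hperf₂ histr₂ hpf₂ hpp).mp hprim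
  refine (isPrimary_div_iff_of_isPreStep_weak hF₁ hperf₁ histr₁ hpf₁ hφpre).mpr ⟨?_, ?_⟩
  · -- `Div φ ≠ 0`: otherwise `φ` is an isomorphism (isotropic type), hence so is `Ψ(φ)`
    intro h1
    haveI : IsIso φ := histr₁ A φ h1 hφpre
    exact h₂.1 (isIsometry_of_isIso F₂ hF₂.isPreFrobenioid (Ψ.functor.map φ))
  · rintro B₁ B₂ φ₁ φ₂ hφ₁ hφ₂ ⟨f₁, hf₁⟩ ⟨f₂, hf₂⟩
    have hm₁ : Ψ.functor.map φ₁ ≫ Ψ.functor.map f₁ = Ψ.functor.map φ := by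
      rw [← Functor.map_comp, hf₁]
    have hm₂ : Ψ.functor.map φ₂ ≫ Ψ.functor.map f₂ = Ψ.functor.map φ := by
      rw [← Functor.map_comp, hf₂]
    rcases h₂.2 _ _ (hpre φ₁ hφ₁) (hpre φ₂ hφ₂) ⟨_, hm₁⟩ ⟨_, hm₂⟩ with ⟨g', hg'⟩ | ⟨g', hg'⟩
    · refine Or.inl ⟨Ψ.functor.preimage g', Ψ.functor.map_injective ?_⟩
      rw [Functor.map_comp, Functor.map_preimage, hg']
    · refine Or.inr ⟨Ψ.functor.preimage g', Ψ.functor.map_injective ?_⟩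
      rw [Functor.map_comp, Functor.map_preimage, hg']

/-- `Ψ(φ)` is a primary pre-step IFF `φ` is (weakly perf-factorial divisor monoids): `Ψ` preserves and
reflects primary pre-steps.  Twin of `isPrimaryPreStep_map_iff_of_preSteps`.
[cite: MochizukiFrdI2008, Thm. 4.2 (i) p.78] -/
theorem isPrimaryPreStep_map_iff_of_preSteps_weak (Ψ : C₁ ≌ C₂) (hF₁ : IsFrobenioid F₁)
    (hF₂ : IsFrobenioid F₂) (hperf₁ : IsOfPerfectType F₁) (hperf₂ : IsOfPerfectType F₂)
    (histr₁ : IsOfIsotropicType F₁) (histr₂ : IsOfIsotropicType F₂)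
    (hpf₁ : Objectwise (fun M _ => IsPerfFactorialWeak M) Φ₁)
    (hpf₂ : Objectwise (fun M _ => IsPerfFactorialWeak M) Φ₂)
    (hstep : ∀ ⦃X Y : C₁⦄ (φ : X ⟶ Y), IsStep F₁ φ → IsStep F₂ (Ψ.functor.map φ))
    (hpre : ∀ ⦃X Y : C₁⦄ (φ : X ⟶ Y), IsPreStep F₁ φ → IsPreStep F₂ (Ψ.functor.map φ))
    (hpre' : ∀ ⦃X Y : C₂⦄ (φ : X ⟶ Y), IsPreStep F₂ φ → IsPreStep F₁ (Ψ.inverse.map φ))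
    {A B : C₁} (φ : A ⟶ B) : IsPrimaryPreStep F₂ (Ψ.functor.map φ) ↔ IsPrimaryPreStep F₁ φ :=
  ⟨isPrimaryPreStep_of_map_of_preSteps_weak Ψ hF₁ hF₂ hperf₁ hperf₂ histr₁ histr₂ hpf₁ hpf₂ hpre hpre',
    isPrimaryPreStep_map_of_preSteps_weak Ψ hF₁ hF₂ hperf₁ hperf₂ histr₁ histr₂ hpf₁ hpf₂ hstep hpre hpre'⟩

end TwoFrobenioids

end PreFrobenioid

end Literature.AlgebraicGeometry.Frobenioids
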